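import Summits.Schanuel.Schanuel.Theorems.RootDecomp1EHullCorank01

/-!
# RootDecomp1E — HULL CORANK (lens-2 g26 convergence kernel (d)) — continuation (RootDecomp1EHullCorank02): §4–§6: corollaries in item shape for DeepLogDarkAtomSchanuel (stmt-Schanuel-30284) below rank five, the AlmostProductSchanuel level, closed-form separation of 1H's first cells

(lens-2 g26 `HullCorank.lean` f98f23f6…, critic VERDICT 2026-08-30T23:30:20Z: ACCEPTED as the convergence-watch (d) text of record, port GO;
census-1 gen 12 port in two parts ≤ 400 lines, ONE namespace; part 02 imports part 01.)
-/

noncomputable section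

namespace Summit.Schanuel.Schanuel.Theorems.RootDecomp1EHullCorank

open Complex Set IntermediateField
open Summit.Schanuel.Schanuel.Theses.RootDecomp1E (DeepLogDarkAtomSchanuel)
open Summit.Schanuel.Schanuel.Theses.RootDecomp1H (ProductSchanuel RelTowerSchanuel AlmostProductSchanuel
  DeepTowerSchanuel)
open Summit.Schanuel.Schanuel.Theorems.RootDecomp1EAnchor (closedFormField SpanMinimal Saturated Dark AlgFree
  mem_closedFormField_iff exp_mem_closedFormField mem_closedFormField_of_exp_mem isAlgebraic_of_mem_adjoin
  isAlgebraic_of_le mem_closedFormField_of_isAlgebraic_closedFormField exists_nat_lt_of_lt_natCast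
  exists_nat_eq_of_le_natCast span_range_le trdeg_le_of_mem_span trdeg_eq_of_span_eq mem_closedFormField_of_mem_span)
open Summit.Schanuel.Schanuel.Theorems.RootDecomp1HCurveHull (TowerTuple TowerSchanuel towerSchanuel_of_structural
  towerSchanuel_iff_structural CurveCond towerHullSet towerHull mem_towerHull_iff mem_towerHullSet_of_depthOne
  add_mem_towerHullSet smul_mem_towerHullSet zero_mem_towerHullSet exists_tower_of_mem_towerHullSet
  curve_mem_towerHullSet exp_mem_towerHullSet mem_towerHullSet_of_exp_mem range_snoc_union
  trdeg_adjoin_le_one_of_subsingleton depthOne_of_isAlgebraic depthOne_of_isAlgebraic_exp towerSchanuel_of_schanuel)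
open Summit.Schanuel.Schanuel.Theorems.RootDecomp1HTowerCells (trdeg_adjoin_adjoin_eq)
open Summit.Schanuel.Schanuel.Theorems.RootDecomp1HHull (hull_of_product_of_relTower)
open Summit.Schanuel.Schanuel.Theorems.RootDecomp1HStoreys (exists_snoc_span_eq relTowerSchanuelGlue_holds)
open Summit.Schanuel.Schanuel.Theorems.RootDecomp1DFlagSplit (trdeg_adjoin_union_eq_add trdeg_adjoin_le_cardinalMk)
open Literature.NumberTheory.Transcendental (OneMotiveToric.trdeg_mono trdeg_adjoin_le_of_le)

/-! ## 4. Corollaries in item shape: `DeepLogDarkAtomSchanuel` (stmt-Schanuel-30284) below rank five -/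

/-- **DLDK AT RANK `≤ 4` FROM `TowerSchanuel`.**  Of the seven binders of `DeepLogDarkAtomSchanuel` only ℚ-freeness, the
DEEP ANCHOR PAIR (`x, y ∈ span_ℚ z ∩ 𝕃` ℚ-independent) and SPAN-MINIMALITY are used: the pair is a free hull tuple of
corank `n - 2 ≤ 2`. -/
theorem deepLogDark_of_rank_le_four (hTS : TowerSchanuel) {n : ℕ} (hn : n ≤ 4) {z : Fin n → ℂ}
    (hz : LinearIndependent ℚ z)
    (hdeep : ∃ x ∈ Submodule.span ℚ (Set.range z), ∃ y ∈ Submodule.span ℚ (Set.range z),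
      x ∈ closedFormField ∧ y ∈ closedFormField ∧ LinearIndependent ℚ ![x, y])
    (hmin : SpanMinimal n z) :
    (n : Cardinal) ≤ Algebra.trdeg ℚ ↥(adjoin ℚ (range z ∪ range (cexp ∘ z))) := by
  obtain ⟨x, hx, y, hy, hxL, hyL, hxy⟩ := hdeep
  refine le_trdeg_of_hullCorank_le_two hTS hz hmin (ℓ := ![x, y]) hxy ?_ ?_ (by omega)
  · intro j
    fin_cases j
    · exact hx
    · exact hy
  · intro j
    fin_cases j
    · exact mem_towerHullSet_of_mem_closedFormField hTS hxL
    · exact mem_towerHullSet_of_mem_closedFormField hTS hyL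

/-- **UNDER `TowerSchanuel`, ITEM 30284 IS ITS OWN RANK-`≥ 5` LAYER**: `DeepLogDarkAtomSchanuel` follows from its
restriction to `n ≥ 5` (binders verbatim, abbreviated by the `RootDecomp1EAnchor` vocabulary they unfold to). -/
theorem deepLogDarkAtomSchanuel_of_rank_ge_five (hTS : TowerSchanuel)
    (h5 : ∀ (n : ℕ) (z : Fin n → ℂ), 5 ≤ n → LinearIndependent ℚ z → Dark n z → AlgFree n z →
      (∃ x ∈ Submodule.span ℚ (Set.range z), x ≠ 0 ∧ IsAlgebraic ℚ (Complex.exp x)) →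
      (∃ x ∈ Submodule.span ℚ (Set.range z), ∃ y ∈ Submodule.span ℚ (Set.range z),
        x ∈ closedFormField ∧ y ∈ closedFormField ∧ LinearIndependent ℚ ![x, y]) →
      SpanMinimal n z → Saturated n z →
      (n : Cardinal) ≤ Algebra.trdeg ℚ ↥(adjoin ℚ (range z ∪ range (cexp ∘ z)))) :
    DeepLogDarkAtomSchanuel := by
  intro n z hz hdark halg hlog hdeep hmin hsat
  by_cases hn : n ≤ 4
  · exact deepLogDark_of_rank_le_four hTS hn hz hdeep hmin
  · exact h5 n z (by omega) hz hdark halg hlog hdeep hmin hsat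

/-- The converse bookkeeping: the item implies its rank-`≥ 5` layer (trivially), so under `TowerSchanuel` the two are
EQUIVALENT. -/
theorem deepLogDarkAtomSchanuel_iff_rank_ge_five (hTS : TowerSchanuel) :
    DeepLogDarkAtomSchanuel ↔
    (∀ (n : ℕ) (z : Fin n → ℂ), 5 ≤ n → LinearIndependent ℚ z → Dark n z → AlgFree n z →
      (∃ x ∈ Submodule.span ℚ (Set.range z), x ≠ 0 ∧ IsAlgebraic ℚ (Complex.exp x)) →
      (∃ x ∈ Submodule.span ℚ (Set.range z), ∃ y ∈ Submodule.span ℚ (Set.range z),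
        x ∈ closedFormField ∧ y ∈ closedFormField ∧ LinearIndependent ℚ ![x, y]) →
      SpanMinimal n z → Saturated n z →
      (n : Cardinal) ≤ Algebra.trdeg ℚ ↥(adjoin ℚ (range z ∪ range (cexp ∘ z)))) :=
  ⟨fun h n z _ hz hdark halg hlog hdeep hmin hsat => h n z hz hdark halg hlog hdeep hmin hsat,
    deepLogDarkAtomSchanuel_of_rank_ge_five hTS⟩

/-- **THE RESIDUAL LAYER OF ITEM 30284 UNDER `TowerSchanuel`, verbatim reduction.**  `DeepLogDarkAtomSchanuel` follows
from its restriction to the tuples `z` of HULL-CORANK `≥ 3`: every ℚ-free tuple of hull numbers inside `span_ℚ z` has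
length `≤ n - 3` (so in particular `n ≥ 5`, the deep anchor pair being such a tuple of length `2`).  This is the exact
complement of what §3 decides; lens-2 claims no kernel inclusion on it (it is where a coordinate lies OFF the hull,
the domain of 1H's residual `BridgeTransverse`). -/
theorem deepLogDarkAtomSchanuel_of_hullCorank_ge_three (hTS : TowerSchanuel)
    (h3 : ∀ (n : ℕ) (z : Fin n → ℂ), LinearIndependent ℚ z → Dark n z → AlgFree n z →
      (∃ x ∈ Submodule.span ℚ (Set.range z), x ≠ 0 ∧ IsAlgebraic ℚ (Complex.exp x)) →
      (∃ x ∈ Submodule.span ℚ (Set.range z), ∃ y ∈ Submodule.span ℚ (Set.range z),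
        x ∈ closedFormField ∧ y ∈ closedFormField ∧ LinearIndependent ℚ ![x, y]) →
      SpanMinimal n z → Saturated n z →
      (∀ (a : ℕ) (ℓ : Fin a → ℂ), LinearIndependent ℚ ℓ → (∀ j, ℓ j ∈ Submodule.span ℚ (Set.range z)) →
        (∀ j, ℓ j ∈ towerHullSet) → a + 3 ≤ n) →
      (n : Cardinal) ≤ Algebra.trdeg ℚ ↥(adjoin ℚ (range z ∪ range (cexp ∘ z)))) :
    DeepLogDarkAtomSchanuel := by
  intro n z hz hdark halg hlog hdeep hmin hsat
  by_cases hc : ∃ (a : ℕ) (ℓ : Fin a → ℂ), LinearIndependent ℚ ℓ ∧ (∀ j, ℓ j ∈ Submodule.span ℚ (Set.range z)) ∧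
      (∀ j, ℓ j ∈ towerHullSet) ∧ n ≤ a + 2
  · obtain ⟨a, ℓ, hℓ, hℓz, hℓh, hna⟩ := hc
    exact le_trdeg_of_hullCorank_le_two hTS hz hmin hℓ hℓz hℓh hna
  · push Not at hc
    exact h3 n z hz hdark halg hlog hdeep hmin hsat fun a ℓ hℓ hℓz hℓh => by
      have := hc a ℓ hℓ hℓz hℓh; omega

/-- `TowerSchanuel` from the three pieces of route RootDecomp1H (`ProductSchanuel`, `AlmostProductSchanuel` 29909,
`DeepTowerSchanuel` 29910), through the landed glue `relTowerSchanuelGlue_holds` and `towerSchanuel_of_structural`. -/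
theorem towerSchanuel_of_pieces (hP : ProductSchanuel) (hA : AlmostProductSchanuel) (hD : DeepTowerSchanuel) :
    TowerSchanuel :=
  towerSchanuel_of_structural hP
    ((show AlmostProductSchanuel → DeepTowerSchanuel → RelTowerSchanuel from relTowerSchanuelGlue_holds) hA hD)

/-- **CONVERGENCE (d), kernel form.**  The three 1H pieces decide every instance of 1E's residual DLDK of rank `≤ 4`. -/
theorem deepLogDark_of_rank_le_four_of_pieces (hP : ProductSchanuel) (hA : AlmostProductSchanuel)
    (hD : DeepTowerSchanuel) {n : ℕ} (hn : n ≤ 4) {z : Fin n → ℂ} (hz : LinearIndependent ℚ z)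
    (hdeep : ∃ x ∈ Submodule.span ℚ (Set.range z), ∃ y ∈ Submodule.span ℚ (Set.range z),
      x ∈ closedFormField ∧ y ∈ closedFormField ∧ LinearIndependent ℚ ![x, y])
    (hmin : SpanMinimal n z) :
    (n : Cardinal) ≤ Algebra.trdeg ℚ ↥(adjoin ℚ (range z ∪ range (cexp ∘ z))) :=
  deepLogDark_of_rank_le_four (towerSchanuel_of_pieces hP hA hD) hn hz hdeep hmin

/-- … and, of course, Schanuel itself does (sanity of the direction: `Schanuel → TowerSchanuel`). -/
theorem deepLogDark_of_rank_le_four_of_schanuel (h : _root_.Schanuel) {n : ℕ} (hn : n ≤ 4) {z : Fin n → ℂ}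
    (hz : LinearIndependent ℚ z)
    (hdeep : ∃ x ∈ Submodule.span ℚ (Set.range z), ∃ y ∈ Submodule.span ℚ (Set.range z),
      x ∈ closedFormField ∧ y ∈ closedFormField ∧ LinearIndependent ℚ ![x, y])
    (hmin : SpanMinimal n z) :
    (n : Cardinal) ≤ Algebra.trdeg ℚ ↥(adjoin ℚ (range z ∪ range (cexp ∘ z))) :=
  deepLogDark_of_rank_le_four (towerSchanuel_of_schanuel h) hn hz hdeep hmin

/-! ## 5. The `AlmostProductSchanuel` level: atomic corank one, and DLDK's declared first cell -/

/-- **ATOMIC CORANK ONE.**  `ProductSchanuel ∧ AlmostProductSchanuel` decide every ℚ-free `z` of rank `m + 1` whose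
ℚ-span contains `m` ℚ-free DEPTH-ONE numbers (re-base the span on them, landed `exists_snoc_span_eq`; fineness of the
new basis is `ProductSchanuel`). -/
theorem le_trdeg_of_atomicCorank_one (hP : ProductSchanuel) (hA : AlmostProductSchanuel) {m : ℕ}
    {z : Fin (m + 1) → ℂ} (hz : LinearIndependent ℚ z) {u : Fin m → ℂ}
    (hdep : ∀ j, Algebra.trdeg ℚ ↥(adjoin ℚ ({u j, cexp (u j)} : Set ℂ)) ≤ 1) (hu : LinearIndependent ℚ u)
    (hmem : ∀ j, u j ∈ Submodule.span ℚ (range z)) :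
    ((m + 1 : ℕ) : Cardinal) ≤ Algebra.trdeg ℚ ↥(adjoin ℚ (range z ∪ range (cexp ∘ z))) := by
  obtain ⟨j, hli', hss⟩ := exists_snoc_span_eq hz hu hmem
  have h := hA m u (z j) hdep hli' (fun k v hv hvli _ => hP k v hv hvli)
  have h1 : ∀ j', (Fin.snoc u (z j) : Fin (m + 1) → ℂ) j' ∈ Submodule.span ℚ (range z) := fun j' => by
    rw [hss]; exact Submodule.subset_span ⟨j', rfl⟩
  have h2 : ∀ i, z i ∈ Submodule.span ℚ (range (Fin.snoc u (z j) : Fin (m + 1) → ℂ)) := fun i => by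
    rw [← hss]; exact Submodule.subset_span ⟨i, rfl⟩
  calc ((m + 1 : ℕ) : Cardinal)
      ≤ Algebra.trdeg ℚ ↥(adjoin ℚ (range (Fin.snoc u (z j) : Fin (m + 1) → ℂ) ∪
          range (cexp ∘ (Fin.snoc u (z j) : Fin (m + 1) → ℂ)))) := h
    _ = Algebra.trdeg ℚ ↥(adjoin ℚ (range z ∪ range (cexp ∘ z))) := trdeg_eq_of_span_eq h1 h2

/-- `iπ` is depth one (`e^{iπ} = -1`). -/
theorem depthOne_pi_mul_I : Algebra.trdeg ℚ ↥(adjoin ℚ ({(Real.pi : ℂ) * I, cexp ((Real.pi : ℂ) * I)} : Set ℂ)) ≤ 1 :=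
  depthOne_of_isAlgebraic_exp (by rw [Complex.exp_pi_mul_I]; exact isAlgebraic_one.neg)

/-- A fixed point of `exp` is depth one. -/
theorem depthOne_of_exp_eq_self {ζ : ℂ} (hζ : cexp ζ = ζ) :
    Algebra.trdeg ℚ ↥(adjoin ℚ ({ζ, cexp ζ} : Set ℂ)) ≤ 1 :=
  trdeg_adjoin_le_one_of_subsingleton (by rw [hζ, Set.pair_eq_singleton]; exact Set.subsingleton_singleton)

/-- The conjugate of a fixed point of `exp` is a fixed point of `exp`. -/
theorem exp_conj_eq_self {ζ : ℂ} (hζ : cexp ζ = ζ) : cexp ((starRingEnd ℂ) ζ) = (starRingEnd ℂ) ζ := by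
  rw [Complex.exp_conj, hζ]

/-- A logarithm of `2` is depth one. -/
theorem depthOne_log_two : Algebra.trdeg ℚ ↥(adjoin ℚ ({Complex.log 2, cexp (Complex.log 2)} : Set ℂ)) ≤ 1 :=
  depthOne_of_isAlgebraic_exp (by
    rw [Complex.exp_log two_ne_zero]
    exact_mod_cast isAlgebraic_algebraMap (R := ℚ) (A := ℂ) 2)

/-- **DLDK'S DECLARED FIRST CELL IS AN `AlmostProductSchanuel` CELL.**  For a fixed point `ζ₀ = e^{ζ₀}`, the tuple
`(iπ, π, ζ₀, conj ζ₀)` — if ℚ-free — is decided by `ProductSchanuel ∧ AlmostProductSchanuel`: its span contains the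
three ℚ-free depth-one numbers `iπ, ζ₀, conj ζ₀` (atomic corank one).  No `DeepTowerSchanuel` is needed here. -/
theorem firstCell_of_prod_aps (hP : ProductSchanuel) (hA : AlmostProductSchanuel) (ζ : ℂ) (hζ : cexp ζ = ζ)
    (hli : LinearIndependent ℚ ![(Real.pi : ℂ) * I, (Real.pi : ℂ), ζ, (starRingEnd ℂ) ζ]) :
    ((4 : ℕ) : Cardinal) ≤ Algebra.trdeg ℚ ↥(adjoin ℚ (range ![(Real.pi : ℂ) * I, (Real.pi : ℂ), ζ, (starRingEnd ℂ) ζ] ∪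
      range (cexp ∘ ![(Real.pi : ℂ) * I, (Real.pi : ℂ), ζ, (starRingEnd ℂ) ζ]))) := by
  have hu : LinearIndependent ℚ ![(Real.pi : ℂ) * I, ζ, (starRingEnd ℂ) ζ] := by
    have h := hli.comp (Fin.succAbove (1 : Fin 4)) (Fin.succAbove_right_injective)
    convert h using 1
    funext i
    fin_cases i <;> rfl
  refine le_trdeg_of_atomicCorank_one (m := 3) hP hA hli (u := ![(Real.pi : ℂ) * I, ζ, (starRingEnd ℂ) ζ]) ?_ hu ?_
  · intro j
    fin_cases j
    · exact depthOne_pi_mul_I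
    · exact depthOne_of_exp_eq_self hζ
    · exact depthOne_of_exp_eq_self (exp_conj_eq_self hζ)
  · intro j
    fin_cases j
    · exact Submodule.subset_span ⟨0, rfl⟩
    · exact Submodule.subset_span ⟨2, rfl⟩
    · exact Submodule.subset_span ⟨3, rfl⟩

/-- The LOG-ANCHORED variant `(iπ, log 2, ζ₀, conj ζ₀)` is a plain `ProductSchanuel` cell (all four atoms depth one). -/
theorem logCell_of_prod (hP : ProductSchanuel) (ζ : ℂ) (hζ : cexp ζ = ζ)
    (hli : LinearIndependent ℚ ![(Real.pi : ℂ) * I, Complex.log 2, ζ, (starRingEnd ℂ) ζ]) :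
    ((4 : ℕ) : Cardinal) ≤ Algebra.trdeg ℚ ↥(adjoin ℚ (range ![(Real.pi : ℂ) * I, Complex.log 2, ζ, (starRingEnd ℂ) ζ] ∪
      range (cexp ∘ ![(Real.pi : ℂ) * I, Complex.log 2, ζ, (starRingEnd ℂ) ζ]))) := by
  refine hP 4 _ ?_ hli
  intro j
  fin_cases j
  · exact depthOne_pi_mul_I
  · exact depthOne_log_two
  · exact depthOne_of_exp_eq_self hζ
  · exact depthOne_of_exp_eq_self (exp_conj_eq_self hζ)

/-! ## 6. Separation at the type level, certified: the named first cells of 1H's residual side are CLOSED-FORM -/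

/-- Algebraic numbers are closed-form. -/
theorem mem_closedFormField_of_isAlgebraic {x : ℂ} (hx : IsAlgebraic ℚ x) : x ∈ closedFormField :=
  mem_closedFormField_of_isAlgebraic_closedFormField (hx.tower_top (L := ↥closedFormField))

/-- `iπ ∈ 𝕃` (a logarithm of `-1`). -/
theorem pi_mul_I_mem_closedFormField : (Real.pi : ℂ) * I ∈ closedFormField :=
  mem_closedFormField_of_exp_mem (by rw [Complex.exp_pi_mul_I]; exact mem_closedFormField_of_isAlgebraic isAlgebraic_one.neg)

/-- `I` is algebraic (`I² + 1 = 0`). -/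
private theorem isAlgebraic_I : IsAlgebraic ℚ I :=
  ⟨Polynomial.X ^ 2 + Polynomial.C 1, Polynomial.X_pow_add_C_ne_zero (by norm_num) 1, by simp [Complex.I_sq]⟩

/-- `π ∈ 𝕃` (`π = iπ · (-i)`). -/
theorem pi_mem_closedFormField : (Real.pi : ℂ) ∈ closedFormField := by
  have h : (Real.pi : ℂ) = (Real.pi : ℂ) * I * (-I) := by
    rw [mul_assoc, mul_neg, Complex.I_mul_I, neg_neg, mul_one]
  rw [h]
  exact mul_mem pi_mul_I_mem_closedFormField (mem_closedFormField_of_isAlgebraic isAlgebraic_I.neg)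

/-- The DEEP / APS first cell `(1, e, e^e)` of route 1H is CLOSED-FORM: every coordinate lies in `𝕃`. -/
theorem one_e_ee_mem_closedFormField : ∀ j, ![(1 : ℂ), cexp 1, cexp (cexp 1)] j ∈ closedFormField := by
  intro j
  fin_cases j
  · exact mem_closedFormField_of_isAlgebraic isAlgebraic_one
  · exact exp_mem_closedFormField (mem_closedFormField_of_isAlgebraic isAlgebraic_one)
  · exact exp_mem_closedFormField (exp_mem_closedFormField (mem_closedFormField_of_isAlgebraic isAlgebraic_one))

/-- The DEEP first cell `(iπ, π, e^π)` of route 1H is CLOSED-FORM. -/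
theorem ipi_pi_epi_mem_closedFormField : ∀ j, ![(Real.pi : ℂ) * I, (Real.pi : ℂ), cexp (Real.pi : ℂ)] j ∈ closedFormField := by
  intro j
  fin_cases j
  · exact pi_mul_I_mem_closedFormField
  · exact pi_mem_closedFormField
  · exact exp_mem_closedFormField pi_mem_closedFormField

/-- Hence neither cell is DARK: they lie on 1E's `ClosedFormAtomSchanuel` (27517) side and never meet DLDK (30284). -/
theorem not_dark_firstCells :
    ¬ Dark 3 ![(1 : ℂ), cexp 1, cexp (cexp 1)] ∧ ¬ Dark 3 ![(Real.pi : ℂ) * I, (Real.pi : ℂ), cexp (Real.pi : ℂ)] :=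
  ⟨fun ⟨i, hi⟩ => hi (one_e_ee_mem_closedFormField i), fun ⟨i, hi⟩ => hi (ipi_pi_epi_mem_closedFormField i)⟩

end Summit.Schanuel.Schanuel.Theorems.RootDecomp1EHullCorank
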